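import Summits.BirchSwinnertonDyer.BirchSwinnertonDyer.Theorems.SignedBaseChangeRev14Glue

/-!
# SignedBaseChange — closer of the acanchor split glue item `TwistPairCanonicalAcanchorGlue`
(rev 15-AC split of the deciding crux K1″ `TwistPairGreenbergProductDivisibilityCanonical`
(stmt-BirchSwinnertonDyer-20519) into `AnticyclotomicEisensteinDivisibility` and
`TwoVariableEulerSystemDivisibility`; director token W-15 (2)). One line over the landed by-name glue
`SignedBaseChangeRev14Glue.twistPairGreenbergProductDivisibilityCanonical_of_acanchorChildren`
(p541190), itself the strategist's landed acanchor composition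
`SignedBaseChangeK1Acanchor.twistPairGreenbergProductDivisibilityCanonical_of_eulerSystem_of_acDiv_of_prop422`
(p534867/p536497) fed with `hIn.1` = BCS 2025 Prop. 4.2.2 (guarded v2). Planner bsd-wall-ss g6.
-/

namespace Summit.BirchSwinnertonDyer.BirchSwinnertonDyer.Theorems.SignedBaseChangeAcanchorGlueCloser

open Summit.BirchSwinnertonDyer.BirchSwinnertonDyer.Theses.SignedBaseChange

/-- `AnticyclotomicEisensteinDivisibility → TwoVariableEulerSystemDivisibility →
TwistPairGreenbergProductDivisibilityCanonical`. -/
theorem twistPairCanonicalAcanchorGlue_holds : TwistPairCanonicalAcanchorGlue :=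
  fun hD hE =>
    SignedBaseChangeRev14Glue.twistPairGreenbergProductDivisibilityCanonical_of_acanchorChildren hD hE

end Summit.BirchSwinnertonDyer.BirchSwinnertonDyer.Theorems.SignedBaseChangeAcanchorGlueCloser
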